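import Summits.CriticalPhenomena.CardyFormulaZ2.Theorems.CardyComplexConeParafermionToSLESixFamiliesDefs
import Summits.CriticalPhenomena.CardyFormulaZ2.Theorems.CardyComplexConeParafermionToSLESixFamiliesPercDomainMarkov
import HarnessLib

/-!
# The martingale clauses of the clock form from the percolation slit expectation

Route `CardyComplexCone` (sub-problem `CriticalPhenomena/CardyFormulaZ2`), crux
`Summit.CriticalPhenomena.CardyFormulaZ2.Theses.CardyComplexCone.ParafermionToSLESixFamilies`
(item stmt-CriticalPhenomena-11389), line `caratheodory-net-slit-uniformity`, stub
`stub_slitMartingaleData`. Per-scale bridge from the domain Markov property of the medial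
exploration under `Pc` (`…PercDomainMarkov.lean`) to the two martingale clauses of the clock form
`PercParaClockData` of the slit-observable approximation (`…Reduction.lean`): with the exploration
filtration and the twisted passage sum of the crux's observable as the variable, the conditional
expectations `Pc[X | 𝒢_n]` are a.e. the everywhere-defined percolation slit expectations, so that
SURE estimates on `c · percSlitExpectation_n X` (the objects the line's steps (4a)–(4b) estimate:
observables of slit data) give the a.e. clauses of the clock form.
-/

noncomputable section

open scoped Topology NNReal ENNReal
open Filter Set MeasureTheory
open Literature.Probability Literature.Probability.LatticeModels Literature.Probability.Percolation
open Literature.Probability.LatticeModels.DiscreteDobrushin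

namespace Summit.CriticalPhenomena.CardyFormulaZ2.Cruxes.ParafermionToSLESixFamilies.CaratheodoryNetSlitUniformity

/-- **The two martingale clauses of the clock form from the percolation slit expectation** (per
scale; the bridge from `…PercDomainMarkov.lean` to `PercParaClockData` in the case where the
exploration of the datum `E` runs from `a` to `b`, so that the exploration filtration
`explorationFiltration hE` is the filtration of the interface `bondInterfaceIn D E`): with
`𝒢 = explorationFiltration hE` and `X = ∑_{passages of γ(ω) through z} e^{-iσW}` the twisted
passage sum at a medial vertex `z` (bounded by `2`, `norm_passageSum_fkInterface_le_two`;
measurable, `measurable_of_medialExploration`), the conditional expectations `Pc[X | 𝒢_n]` are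
a.e. the everywhere-defined slit expectations `percSlitExpectation hE half n X`
(`condExp_explorationFiltration_ae_eq_percSlitExpectation`), so SURE bounds
`‖c · percSlitExpectation_n X‖ ≤ C` and `‖c · percSlitExpectation_n X - N_n‖ ≤ ε` (off `bad`, for
the relevant `n`) give the a.e. clauses `‖c · Pc[X | 𝒢_n]‖ ≤ C`,
`‖c · Pc[X | 𝒢_n] - N_n‖ ≤ ε` of `PercParaClockData`. -/
theorem ae_clockClauses_of_percSlitExpectation : ∀ {E : DiscreteDobrushin} (hE : E.IsZdAdmissible) (σ : ℝ) (z : MedialVertex) (c : ℂ) {C : ℝ} {M : ℕ} {bad : Set (BondConfig (Site 2))} {good : ℕ → BondConfig (Site 2) → Prop} {N : ℕ → BondConfig (Site 2) → ℂ} {ε : ℝ}, (∀ ω n, n ≤ M → ‖c * percSlitExpectation hE half n (fun ω ↦ MedialPath.passageSum (medialExploration E ω) E.δ σ z) ω‖ ≤ C) → (∀ ω, ω ∉ bad → ∀ n, n ≤ M → good n ω → ‖c * percSlitExpectation hE half n (fun ω ↦ MedialPath.passageSum (medialExploration E ω) E.δ σ z) ω - N n ω‖ ≤ ε) → (∀ᵐ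 ω ∂Pc, ∀ n, n ≤ M → ‖c * Pc[fun ω ↦ MedialPath.passageSum (medialExploration E ω) E.δ σ z|explorationFiltration hE n] ω‖ ≤ C) ∧ (∀ᵐ ω ∂Pc, ω ∉ bad → ∀ n, n ≤ M → good n ω → ‖c * Pc[fun ω ↦ MedialPath.passageSum (medialExploration E ω) E.δ σ z|explorationFiltration hE n] ω - N n ω‖ ≤ ε) := by
  intro E hE σ z c C M bad good N ε hbdd happ
  set X : BondConfig (Site 2) → ℂ :=
    fun ω ↦ MedialPath.passageSum (medialExploration E ω) E.δ σ z with hX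
  have hXm : Measurable X :=
    measurable_of_medialExploration E fun ω ω' h' ↦ by simp only [hX, h']
  have hX2 : ∀ ω, ‖X ω‖ ≤ 2 := fun ω ↦ by
    simp only [hX]
    rw [MedialPath.passageSum_medialExploration_eq]
    exact norm_passageSum_fkInterface_le_two hE ω E.δ σ z
  -- the domain Markov property: `Pc[X | 𝒢_n]` is a.e. the slit expectation, for all `n` at once
  have hce : ∀ᵐ ω ∂Pc, ∀ n : ℕ, (Pc[X|explorationFiltration hE n]) ω =
      percSlitExpectation hE half n X ω := by
    rw [ae_all_iff]
    intro n
    exact condExp_explorationFiltration_ae_eq_percSlitExpectation (hD := hE) half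
      hXm.stronglyMeasurable hX2 n
  constructor
  · filter_upwards [hce] with ω hω n hn
    rw [hω n]
    exact hbdd ω n hn
  · filter_upwards [hce] with ω hω hωbad n hn hgood
    rw [hω n]
    exact happ ω hωbad n hn hgood

end Summit.CriticalPhenomena.CardyFormulaZ2.Cruxes.ParafermionToSLESixFamilies.CaratheodoryNetSlitUniformity

end
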